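import Summits.QuantumFields.BalabanUV.Beta.EriceFlowEnclosureLogScalePowerScales
import Summits.QuantumFields.BalabanUV.Beta.EriceFlowEnclosureLogMeanPowerScales

/-!
# Beta / EriceFlowEnclosureLogScalePowerScalesClock — THE CLOCK TRANSPORTS THE TAUBERIAN CLASS: for M log-Lipschitz on ]0, δ[ and L₀ > 0,
# **M is slowly decreasing on the POWER SCALES at 0⁺ (P2 #55d's function condition, normalised at L₀) ⟺ its samples `M(L₀∕(n+1))` along the
# ideal two-loop clock are slowly decreasing on the power scales (P2 #54i's sequence condition)** — so gen 37's two Tauberian classes for the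
# logarithmic method (Móricz Cor. 3 for the samples, P2 #54i; Cor. 1 for the function, P2 #55d) are ONE condition read on the two sides of the
# clock, exactly as the two logarithmic averages are one number (P2 #55b∕#55c).  ⟹ is verbatim (y = N+1, u = i+1); ⟸ pays `C∕y` twice for the
# cells between a real scale and the next integer one and shrinks the exponent (λ ↦ (1+λ)∕2) to absorb the `+1`.  With P2 #54i BY NAME
# (Cor. 3) and P2 #55b's clock independence: in the class, the logarithmic cutoff average along ANY clock with constant L₀ decides the datum.
#   §1 `samples_powerScaleSD_of_function` (any M); §2 `rpow_gap` (`y^{λ′} + 1 ≤ y^λ` for `y ≥ 2^{1∕(λ−λ′)}`, y ≥ 1), `cell_near`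
#      (`|M(L₀∕w) − M(L₀∕v)| ≤ C∕v` for `v ≤ w ≤ v + 1`), **`function_powerScaleSD_of_samples`** (log-Lipschitz); §3 END
#      **`powerScaleSD_function_iff_samples`**, **`tendsto_of_logCutoffAverage_samplesPowerScaleSD`** (any clock `n·h_n → L₀`: class on the
#      ideal samples + ℓ-cutoff average along h → m ⟹ `M → m` at 0⁺ — P2 #55b `logCutoffAverage_clock_independent`, P2 #54i, P2 #53b
#      `tendsto_of_tendsto_sampled`), **`logCutoffAverage_iff_tendsto_of_samplesPowerScaleSD`**; §4 ⟦v1.1⟧ the sample class is CLOCK-INDEPENDENT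
#      (`samples_powerScaleSD_clock_transfer`), so the samples along ANY clock `n·h_n → L₀` are in the class ⟺ M is (`powerScaleSD_function_iff_samples_clock`).
# (β-flow team, prover 2 = lower ∕ positivity side, unit `b2b-balaban-beta-bflow-p2`, gen 38; module P2 #55f; pure [folklore]; no Erice sentence)

HONEST FRAMING (page 1 of everything the β sub-cell writes): discharging `BetaPertH` makes Bałaban's UV stability UNCONDITIONAL — a
real constructive-QFT result; it is NOT the continuum limit and NOT the Clay problem.  HONEST DEPENDENCY (cell reorg 2026-08-19,
verbatim): «continuum YM on T⁴ ⇐ BetaPertH ∧ nine spine estimates (0/9 proved); BetaPertH ⇐ (D1) ∧ (D4) ∧ CAP+tail; G-an2-4 gates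
asym, D1 and NE2/3/4.»  THIS MODULE DISCHARGES NOTHING and quotes nothing: [folklore] real analysis (floors, `Real.rpow`, the lineage's
log-Lipschitz shape); the Tauberian theorem used in §3 is the tree's PROVED fact (Móricz 2013 Cor. 3) through P2 #54i.

WHAT THIS FILE PROVES (0 sorry, 0 def): §1 `samples_powerScaleSD_of_function`; §2 `rpow_gap`, `cell_near`, **`function_powerScaleSD_of_samples`**;
§3 END **`powerScaleSD_function_iff_samples`**, **`tendsto_of_logCutoffAverage_samplesPowerScaleSD`**, **`logCutoffAverage_iff_tendsto_of_samplesPowerScaleSD`**;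
§4 ⟦v1.1⟧ `samples_powerScaleSD_clock_transfer` (the sample class is the same along any two clocks with the same L₀), END
**`powerScaleSD_function_iff_samples_clock`** (samples along ANY clock `n·h_n → L₀` ⟺ the function class at L₀).
NOT CLAIMED: independence of the normalisation (the function class at c ≠ L₀ vs at L₀ — true up to shrinking λ, not filed); `BetaPertH`; continuum; Clay.
-/

namespace Summit.QuantumFields.BalabanUV.Beta.EriceFlowEnclosureLogScalePowerScalesClock

open Set Filter Topology
open Summit.QuantumFields.BalabanUV.Beta.EriceFlowEnclosureCesaroClockHarmonic (comp_logLip)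
open Summit.QuantumFields.BalabanUV.Beta.EriceFlowEnclosureCesaroClockSampling (tendsto_of_tendsto_sampled tendsto_sampled_of_tendsto)
open Summit.QuantumFields.BalabanUV.Beta.EriceFlowEnclosureWeightedClockSampling (escape_clock)
open Summit.QuantumFields.BalabanUV.Beta.EriceFlowEnclosureLogMeanPowerScales (tendsto_of_logMean_powerScaleSlowlyDecreasing)
open Summit.QuantumFields.BalabanUV.Beta.EriceFlowEnclosureLogMeanClockIntegralLimit (logCutoffAverage_clock_independent)
open Summit.QuantumFields.BalabanUV.Beta.EriceFlowEnclosureLogMeanSeq (logMean_of_tendsto)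

noncomputable section

variable {M : ℝ → ℝ} {δ C L₀ : ℝ}

/-! ## §1 From the function to the samples (verbatim) -/

/-- **FUNCTION CLASS ⟹ SAMPLE CLASS** (any M, any L₀): if for every ε > 0 there are y₀ > 1, λ > 1 with `M(L₀∕u) − M(L₀∕y) ≥ −ε` whenever
`y₀ ≤ y < u ≤ y^λ`, then the samples `a_n = M(L₀∕(n+1))` satisfy P2 #54i's condition: `a_i − a_N ≥ −ε` whenever `N₀ ≤ N < i`, `i+1 ≤ (N+1)^λ`
(take `N₀ = ⌈y₀⌉`, `y = N+1`, `u = i+1`). [folklore] -/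
theorem samples_powerScaleSD_of_function (L₀ : ℝ)
    (hsd : ∀ ε : ℝ, 0 < ε → ∃ (y₀ l : ℝ), 1 < y₀ ∧ 1 < l ∧
      ∀ y u : ℝ, y₀ ≤ y → y < u → u ≤ y ^ l → -ε ≤ M (L₀ / u) - M (L₀ / y)) :
    ∀ ε : ℝ, 0 < ε → ∃ (N₀ : ℕ) (l : ℝ), 1 < l ∧
      ∀ N i : ℕ, N₀ ≤ N → N < i → (i : ℝ) + 1 ≤ ((N : ℝ) + 1) ^ l →
        -ε ≤ M (L₀ / ((i : ℝ) + 1)) - M (L₀ / ((N : ℝ) + 1)) := by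
  intro ε hε
  obtain ⟨y₀, l, _, hl, h⟩ := hsd ε hε
  refine ⟨⌈y₀⌉₊, l, hl, fun N i hN hNi hil => h _ _ ?_ ?_ hil⟩
  · have h1 : y₀ ≤ ⌈y₀⌉₊ := Nat.le_ceil y₀
    have h2 : ((⌈y₀⌉₊ : ℕ) : ℝ) ≤ N := by exact_mod_cast hN
    linarith
  · have : (N : ℝ) < i := by exact_mod_cast hNi
    linarith

/-! ## §2 From the samples to the function (log-Lipschitz) -/

/-- THE EXPONENT GAP ABSORBS THE `+1`: for `1 ≤ y`, `0 ≤ λ′`, `0 < λ − λ′` and `2^{1∕(λ−λ′)} ≤ y`: **`y^{λ′} + 1 ≤ y^λ`**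
(`y^λ = y^{λ′}·y^{λ−λ′} ≥ 2·y^{λ′} ≥ y^{λ′} + 1`). [folklore] -/
theorem rpow_gap {y l l' : ℝ} (hy : 1 ≤ y) (hl' : 0 ≤ l') (hll' : 0 < l - l') (hy2 : (2:ℝ) ^ (l - l')⁻¹ ≤ y) :
    y ^ l' + 1 ≤ y ^ l := by
  have hy0 : 0 < y := by linarith
  have h1 : y ^ l = y ^ l' * y ^ (l - l') := by
    rw [← Real.rpow_add hy0]; ring_nf
  have h2 : (2:ℝ) ≤ y ^ (l - l') := by
    have := Real.rpow_le_rpow (by positivity : (0:ℝ) ≤ (2:ℝ) ^ (l - l')⁻¹) hy2 hll'.le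
    rwa [Real.rpow_inv_rpow (by norm_num : (0:ℝ) ≤ 2) hll'.ne'] at this
  have h3 : 1 ≤ y ^ l' := Real.one_le_rpow hy hl'
  rw [h1]
  nlinarith

/-- THE CELL BETWEEN A REAL SCALE AND THE NEXT INTEGER ONE: M C-log-Lipschitz on ]0, δ[ (C ≥ 0), L₀ > 0, `L₀∕δ < v ≤ w ≤ v + 1` ⟹
**`|M(L₀∕w) − M(L₀∕v)| ≤ C∕v`** (`C·log(w∕v) ≤ C·(w − v)∕v ≤ C∕v`). [folklore] -/
theorem cell_near (hδ : 0 < δ) (hL₀ : 0 < L₀) (hC : 0 ≤ C)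
    (hlip : ∀ t u : ℝ, 0 < t → t ≤ u → u < δ → |M u - M t| ≤ C * Real.log (u / t))
    {v w : ℝ} (hv : L₀ / δ < v) (hvw : v ≤ w) (hw : w ≤ v + 1) :
    |M (L₀ / w) - M (L₀ / v)| ≤ C / v := by
  have hv0 : 0 < v := lt_trans (div_pos hL₀ hδ) hv
  have hw0 : 0 < w := lt_of_lt_of_le hv0 hvw
  have h1 := comp_logLip hδ hL₀ hlip hv hvw
  have hlog : Real.log (w / v) ≤ 1 / v := by
    have := Real.log_le_sub_one_of_pos (div_pos hw0 hv0)
    rw [div_sub_one hv0.ne'] at this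
    exact this.trans (div_le_div_of_nonneg_right (by linarith) hv0.le)
  calc |M (L₀ / w) - M (L₀ / v)| ≤ C * Real.log (w / v) := h1
    _ ≤ C * (1 / v) := mul_le_mul_of_nonneg_left hlog hC
    _ = C / v := by ring

/-- **SAMPLE CLASS ⟹ FUNCTION CLASS (log-Lipschitz M).**  M C-log-Lipschitz on ]0, δ[ (C ≥ 0), L₀ > 0; if the samples `M(L₀∕(n+1))` are slowly
decreasing on the power scales (P2 #54i's condition) then M is slowly decreasing on the power scales at 0⁺, normalised at L₀: for every ε > 0 there
are y₀ > 1, λ′ > 1 with `M(L₀∕u) − M(L₀∕y) ≥ −ε` whenever `y₀ ≤ y < u ≤ y^{λ′}`.  (Given the sample data N₀, λ for ε∕3: λ′ = (1+λ)∕2,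
N = ⌊y⌋, i = ⌊u⌋; the two cells cost `C∕y ≤ ε∕3` each; if ⌊u⌋ = ⌊y⌋ one cell suffices.) [folklore] -/
theorem function_powerScaleSD_of_samples (hδ : 0 < δ) (hL₀ : 0 < L₀) (hC : 0 ≤ C)
    (hlip : ∀ t u : ℝ, 0 < t → t ≤ u → u < δ → |M u - M t| ≤ C * Real.log (u / t))
    (hsd : ∀ ε : ℝ, 0 < ε → ∃ (N₀ : ℕ) (l : ℝ), 1 < l ∧
      ∀ N i : ℕ, N₀ ≤ N → N < i → (i : ℝ) + 1 ≤ ((N : ℝ) + 1) ^ l →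
        -ε ≤ M (L₀ / ((i : ℝ) + 1)) - M (L₀ / ((N : ℝ) + 1))) :
    ∀ ε : ℝ, 0 < ε → ∃ (y₀ l : ℝ), 1 < y₀ ∧ 1 < l ∧
      ∀ y u : ℝ, y₀ ≤ y → y < u → u ≤ y ^ l → -ε ≤ M (L₀ / u) - M (L₀ / y) := by
  intro ε hε
  obtain ⟨N₀, l, hl, h⟩ := hsd (ε / 3) (by positivity)
  set l' : ℝ := (1 + l) / 2 with hl'
  have hl'1 : 1 < l' := by rw [hl']; linarith
  have hll' : 0 < l - l' := by rw [hl']; linarith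
  -- the threshold
  set y₀ : ℝ := ((N₀ : ℝ) + 2) + (L₀ / δ + 1) + (3 * C / ε + 1) + ((2 : ℝ) ^ (l - l')⁻¹ + 1) with hy₀
  have hA : (0:ℝ) ≤ (N₀ : ℝ) + 2 := by positivity
  have hB : 0 ≤ L₀ / δ + 1 := by positivity
  have hCε : 0 ≤ 3 * C / ε + 1 := by positivity
  have hD : 0 ≤ (2 : ℝ) ^ (l - l')⁻¹ + 1 := by positivity
  refine ⟨y₀, l', by rw [hy₀]; linarith, hl'1, fun y u hy hyu hul => ?_⟩
  have hyN₀ : (N₀ : ℝ) + 2 ≤ y := by rw [hy₀] at hy; linarith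
  have hyδ : L₀ / δ < y := by rw [hy₀] at hy; linarith
  have hyC : 3 * C / ε < y := by rw [hy₀] at hy; linarith
  have hy2 : (2 : ℝ) ^ (l - l')⁻¹ ≤ y := by rw [hy₀] at hy; linarith
  have hy1 : 1 ≤ y := by linarith
  have hy0 : 0 < y := by linarith
  have hu0 : 0 < u := hy0.trans hyu
  -- C/v ≤ ε/3 for v ≥ y
  have hCy : ∀ v : ℝ, y ≤ v → C / v ≤ ε / 3 := by
    intro v hv
    have hv0 : 0 < v := lt_of_lt_of_le hy0 hv
    rw [div_le_iff₀ hv0]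
    rw [div_lt_iff₀ hε] at hyC
    nlinarith
  -- the near-cell bound
  have near : ∀ v w : ℝ, y ≤ v → v ≤ w → w ≤ v + 1 → |M (L₀ / w) - M (L₀ / v)| ≤ ε / 3 :=
    fun v w hv hvw hw => (cell_near hδ hL₀ hC hlip (lt_of_lt_of_le hyδ hv) hvw hw).trans (hCy v hv)
  -- floors
  have hfl : ⌊y⌋₊ ≤ ⌊u⌋₊ := Nat.floor_le_floor hyu.le
  rcases hfl.eq_or_lt with heq | hlt
  · -- one cell: u < ⌊u⌋ + 1 = ⌊y⌋ + 1 ≤ y + 1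
    have hu1 : u ≤ y + 1 := by
      have h1 := Nat.lt_floor_add_one u
      have h2 := Nat.floor_le hy0.le
      rw [← heq] at h1
      linarith
    have hn := near y u le_rfl hyu.le hu1
    rw [abs_le] at hn
    linarith [hn.1]
  · -- two cells and the sample condition between N = ⌊y⌋ and i = ⌊u⌋
    have hN₀ : N₀ ≤ ⌊y⌋₊ := Nat.le_floor (by linarith)
    have hNy : y < (⌊y⌋₊ : ℝ) + 1 := Nat.lt_floor_add_one y
    have hNy' : (⌊y⌋₊ : ℝ) ≤ y := Nat.floor_le hy0.le
    have hiu : (⌊u⌋₊ : ℝ) ≤ u := Nat.floor_le hu0.le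
    have hiu' : u < (⌊u⌋₊ : ℝ) + 1 := Nat.lt_floor_add_one u
    have hpow : (⌊u⌋₊ : ℝ) + 1 ≤ ((⌊y⌋₊ : ℝ) + 1) ^ l := by
      have h1 : (⌊u⌋₊ : ℝ) + 1 ≤ y ^ l' + 1 := by linarith
      have h2 : y ^ l' + 1 ≤ y ^ l := rpow_gap hy1 (by linarith) hll' hy2
      have h3 : y ^ l ≤ ((⌊y⌋₊ : ℝ) + 1) ^ l := Real.rpow_le_rpow hy0.le hNy.le (by linarith)
      linarith
    have hmid := h ⌊y⌋₊ ⌊u⌋₊ hN₀ hlt hpow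
    have hAcell := near u ((⌊u⌋₊ : ℝ) + 1) hyu.le hiu'.le (by linarith)
    have hBcell := near y ((⌊y⌋₊ : ℝ) + 1) le_rfl hNy.le (by linarith)
    rw [abs_le] at hAcell hBcell
    linarith [hAcell.1, hAcell.2, hBcell.1, hBcell.2]

/-! ## §3 One class on the two sides of the clock -/

/-- **END — ONE TAUBERIAN CLASS, TWO SIDES OF THE CLOCK.**  For M C-log-Lipschitz on ]0, δ[ (C ≥ 0) and L₀ > 0:
**M is slowly decreasing on the power scales at 0⁺ (normalised at L₀) ⟺ its ideal-clock samples `M(L₀∕(n+1))` are** (P2 #54i's condition).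
[folklore] -/
theorem powerScaleSD_function_iff_samples (hδ : 0 < δ) (hL₀ : 0 < L₀) (hC : 0 ≤ C)
    (hlip : ∀ t u : ℝ, 0 < t → t ≤ u → u < δ → |M u - M t| ≤ C * Real.log (u / t)) :
    (∀ ε : ℝ, 0 < ε → ∃ (y₀ l : ℝ), 1 < y₀ ∧ 1 < l ∧
        ∀ y u : ℝ, y₀ ≤ y → y < u → u ≤ y ^ l → -ε ≤ M (L₀ / u) - M (L₀ / y)) ↔
      (∀ ε : ℝ, 0 < ε → ∃ (N₀ : ℕ) (l : ℝ), 1 < l ∧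
        ∀ N i : ℕ, N₀ ≤ N → N < i → (i : ℝ) + 1 ≤ ((N : ℝ) + 1) ^ l →
          -ε ≤ M (L₀ / ((i : ℝ) + 1)) - M (L₀ / ((N : ℝ) + 1))) :=
  ⟨samples_powerScaleSD_of_function L₀, function_powerScaleSD_of_samples hδ hL₀ hC hlip⟩

/-- **IN THE CLASS, THE LOGARITHMIC CUTOFF AVERAGE ALONG ANY CLOCK DECIDES THE DATUM.**  M C-log-Lipschitz on ]0, δ[ (C > 0), `h_n > 0` with
`n·h_n → L₀ > 0`, the ideal samples `M(L₀∕(n+1))` slowly decreasing on the power scales; then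
**`(Σ_{n<N} M(h_n)∕(n+1))∕H_N → m ⟹ M → m` at 0⁺** (clock independence P2 #55b, Móricz Cor. 3 through P2 #54i, P2 #53b). [folklore] -/
theorem tendsto_of_logCutoffAverage_samplesPowerScaleSD (hC : 0 < C) (hδ : 0 < δ)
    (hlip : ∀ t u : ℝ, 0 < t → t ≤ u → u < δ → |M u - M t| ≤ C * Real.log (u / t))
    {h : ℕ → ℝ} (hpos : ∀ n, 0 < h n) (hL₀ : 0 < L₀)
    (hclock : Tendsto (fun n : ℕ => (n : ℝ) * h n) atTop (𝓝 L₀))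
    (hsd : ∀ ε : ℝ, 0 < ε → ∃ (N₀ : ℕ) (l : ℝ), 1 < l ∧
      ∀ N i : ℕ, N₀ ≤ N → N < i → (i : ℝ) + 1 ≤ ((N : ℝ) + 1) ^ l →
        -ε ≤ M (L₀ / ((i : ℝ) + 1)) - M (L₀ / ((N : ℝ) + 1)))
    {m : ℝ} (havg : Tendsto (fun N : ℕ => (∑ n ∈ Finset.range N, ((n : ℝ) + 1)⁻¹ * M (h n)) /
      (∑ n ∈ Finset.range N, ((n : ℝ) + 1)⁻¹)) atTop (𝓝 m)) :
    Tendsto M (𝓝[>] 0) (𝓝 m) := by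
  obtain ⟨hipos, hiclock⟩ := escape_clock hL₀
  have hideal := (logCutoffAverage_clock_independent hδ hlip hpos hipos hL₀ hclock hiclock m).mp havg
  have hsam := tendsto_of_logMean_powerScaleSlowlyDecreasing (a := fun n : ℕ => M (L₀ / ((n : ℝ) + 1))) hsd hideal
  exact tendsto_of_tendsto_sampled hC hδ hlip hipos hL₀ hiclock hsam

/-- IN THE CLASS, ALONG ANY CLOCK: **`ℓ-cutoff average → m ⟺ M → m` at 0⁺** (⟸: `M → m` ⟹ samples → m ⟹ ℓ-mean → m, regularity). [folklore] -/
theorem logCutoffAverage_iff_tendsto_of_samplesPowerScaleSD (hC : 0 < C) (hδ : 0 < δ)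
    (hlip : ∀ t u : ℝ, 0 < t → t ≤ u → u < δ → |M u - M t| ≤ C * Real.log (u / t))
    {h : ℕ → ℝ} (hpos : ∀ n, 0 < h n) (hL₀ : 0 < L₀)
    (hclock : Tendsto (fun n : ℕ => (n : ℝ) * h n) atTop (𝓝 L₀))
    (hsd : ∀ ε : ℝ, 0 < ε → ∃ (N₀ : ℕ) (l : ℝ), 1 < l ∧
      ∀ N i : ℕ, N₀ ≤ N → N < i → (i : ℝ) + 1 ≤ ((N : ℝ) + 1) ^ l →
        -ε ≤ M (L₀ / ((i : ℝ) + 1)) - M (L₀ / ((N : ℝ) + 1))) (m : ℝ) :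
    Tendsto (fun N : ℕ => (∑ n ∈ Finset.range N, ((n : ℝ) + 1)⁻¹ * M (h n)) /
        (∑ n ∈ Finset.range N, ((n : ℝ) + 1)⁻¹)) atTop (𝓝 m) ↔ Tendsto M (𝓝[>] 0) (𝓝 m) :=
  ⟨fun havg => tendsto_of_logCutoffAverage_samplesPowerScaleSD hC hδ hlip hpos hL₀ hclock hsd havg,
    fun hM => logMean_of_tendsto (tendsto_sampled_of_tendsto hpos hclock hM)⟩

/-! ## §4 The class does not see the clock -/

/-- **THE SAMPLE CLASS IS CLOCK-INDEPENDENT**: M C-log-Lipschitz on ]0, δ[, two positive clocks with the same constant `n·h_n → L₀`, `n·h′_n → L₀`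
(L₀ > 0).  If the samples `M(h_n)` are slowly decreasing on the power scales, so are the samples `M(h′_n)` (same exponent; the two sample sequences
differ by a null sequence, P2 #55b `sampled_sub_sampled_tendsto_zero`, which costs ε∕3 twice). [folklore] -/
theorem samples_powerScaleSD_clock_transfer (hδ : 0 < δ)
    (hlip : ∀ t u : ℝ, 0 < t → t ≤ u → u < δ → |M u - M t| ≤ C * Real.log (u / t))
    {h h' : ℕ → ℝ} (hpos : ∀ n, 0 < h n) (hpos' : ∀ n, 0 < h' n) (hL₀ : 0 < L₀)
    (hclock : Tendsto (fun n : ℕ => (n : ℝ) * h n) atTop (𝓝 L₀))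
    (hclock' : Tendsto (fun n : ℕ => (n : ℝ) * h' n) atTop (𝓝 L₀))
    (hsd : ∀ ε : ℝ, 0 < ε → ∃ (N₀ : ℕ) (l : ℝ), 1 < l ∧
      ∀ N i : ℕ, N₀ ≤ N → N < i → (i : ℝ) + 1 ≤ ((N : ℝ) + 1) ^ l → -ε ≤ M (h i) - M (h N)) :
    ∀ ε : ℝ, 0 < ε → ∃ (N₀ : ℕ) (l : ℝ), 1 < l ∧
      ∀ N i : ℕ, N₀ ≤ N → N < i → (i : ℝ) + 1 ≤ ((N : ℝ) + 1) ^ l → -ε ≤ M (h' i) - M (h' N) := by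
  intro ε hε
  obtain ⟨N₀, l, hl, hNi⟩ := hsd (ε / 3) (by positivity)
  have hnull := EriceFlowEnclosureLogMeanClockIntegralLimit.sampled_sub_sampled_tendsto_zero hδ hlip hpos hpos' hL₀ hclock hclock'
  obtain ⟨N₁, hN₁⟩ := (Metric.tendsto_atTop.mp hnull) (ε / 3) (by positivity)
  refine ⟨max N₀ N₁, l, hl, fun N i hN hlt hpow => ?_⟩
  have h1 := hNi N i (le_of_max_le_left hN) hlt hpow
  have h2 := hN₁ N (le_of_max_le_right hN)
  have h3 := hN₁ i ((le_of_max_le_right hN).trans hlt.le)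
  rw [Real.dist_eq, sub_zero, abs_lt] at h2 h3
  linarith [h2.1, h2.2, h3.1, h3.2]

/-- **END — ONE CLASS FOR M AND FOR ITS SAMPLES ALONG ANY CLOCK.**  M C-log-Lipschitz on ]0, δ[ (C ≥ 0), `h_n > 0` with `n·h_n → L₀ > 0`: the samples
`M(h_n)` are slowly decreasing on the power scales ⟺ M is slowly decreasing on the power scales at 0⁺ (normalised at L₀) — §3 for the ideal clock,
§4's transfer between the ideal clock and h. [folklore] -/
theorem powerScaleSD_function_iff_samples_clock (hδ : 0 < δ) (hL₀ : 0 < L₀) (hC : 0 ≤ C)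
    (hlip : ∀ t u : ℝ, 0 < t → t ≤ u → u < δ → |M u - M t| ≤ C * Real.log (u / t))
    {h : ℕ → ℝ} (hpos : ∀ n, 0 < h n) (hclock : Tendsto (fun n : ℕ => (n : ℝ) * h n) atTop (𝓝 L₀)) :
    (∀ ε : ℝ, 0 < ε → ∃ (y₀ l : ℝ), 1 < y₀ ∧ 1 < l ∧
        ∀ y u : ℝ, y₀ ≤ y → y < u → u ≤ y ^ l → -ε ≤ M (L₀ / u) - M (L₀ / y)) ↔
      (∀ ε : ℝ, 0 < ε → ∃ (N₀ : ℕ) (l : ℝ), 1 < l ∧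
        ∀ N i : ℕ, N₀ ≤ N → N < i → (i : ℝ) + 1 ≤ ((N : ℝ) + 1) ^ l → -ε ≤ M (h i) - M (h N)) := by
  obtain ⟨hipos, hiclock⟩ := escape_clock hL₀
  rw [powerScaleSD_function_iff_samples hδ hL₀ hC hlip]
  exact ⟨fun hsd => samples_powerScaleSD_clock_transfer hδ hlip hipos hpos hL₀ hiclock hclock hsd,
    fun hsd => samples_powerScaleSD_clock_transfer hδ hlip hpos hipos hL₀ hclock hiclock hsd⟩

end

end Summit.QuantumFields.BalabanUV.Beta.EriceFlowEnclosureLogScalePowerScalesClock
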